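import Literature.Barriers.PneNP.MCSPHardnessObstructionsThm41Proofs
import Literature.Computability.Complexity.KannanLanguageAE
import Literature.Computability.Complexity.BranchingFn
import Literature.Computability.Complexity.StringCopy
import Literature.Computability.Complexity.CircuitEval
import HarnessLib

/-!
# Barrier `MCSPKarpHardness`: the exact reach of the Murray–Williams obstruction (D-0021 barrier audit, 2026-08-16)

The catalogue entry `Literature.Barriers.PneNP.MCSPKarpHardness` (`MCSPHardnessObstructions.lean`)
vendors Murray–Williams 2017, Thm. 1.6 — "If MCSP is NP-hard under polynomial-time reductions, then
`EXP ≠ NP ∩ P/poly`. Consequently, `EXP ≠ ZPP`" — as `IsNPHard MCSP → EXP ≠ NP ∩ PPoly`, and reads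
it (with Thms. 1.3, 1.5, 1.7, 1.8 and Kabanets–Cai quoted) as an obstruction to "establishing
NP-hardness of the Minimum Circuit Size Problem" bearing on routes PneNP/Circuit2 (crux #2,
"`MCSP ∉ P/poly` as an instance of `NP ⊄ P/poly`"), PneNP/Ktlang (crux #2) and PneNP/MetaCplx (#3).
The audit found the FACT sound — it is a theorem of the tree (`MCSPKarpHardness_holds`,
`MCSPHardnessObstructionsProofs.lean`; Thm. 4.1 likewise, `MurrayWilliams2017_thm_4_1_holds`) — but
both the TECHNIQUE CLASS and the SCOPE of the obstruction narrower than the entry's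
`technique_class:` / `blocks:` lines say. This file records the narrowed barrier
`MCSPKarpHardnessNarrow`, PROVED (`MCSPKarpHardnessNarrow_holds`).

**1. What the theorem excludes is one world, and that world is excluded by almost everything.**
Given `NP ⊆ EXP`, `EXP = NP ∩ P/poly ↔ (NP = EXP ∧ EXP ⊆ P/poly)` (`MCSPKarpHardness.world_iff`);
call the right-hand side `W`. In `W`: `NP ⊆ P/poly`, `NP = coNP`, `NP = EXP`
(`MCSPKarpHardness.world_consequences`), hence `P ≠ NP` (time hierarchy). So the consequence
`¬W` that makes Thm. 1.6 an "implies a breakthrough" obstruction is implied by `NP ⊄ P/poly`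
(`MCSPKarpHardness.not_world_of_not_NP_subset_PPoly`) — the TARGET of route PneNP/Circuit2 and of
every circuit-lower-bound route — by `NP ≠ coNP` (`…of_NP_ne_coNP`, the target of the
proof-complexity routes), by `P = NP` (`…of_P_eq_NP`), by `NP ≠ EXP` and by `EXP ⊄ P/poly`.
Consequently Thm. 1.6 constrains only the ORDER of steps inside a route: Karp NP-hardness of `MCSP`
cannot be a lemma established before (or without) a statement at least as strong as `¬W`; it says
nothing against `NP ⊄ P/poly → IsNPHard MCSP`, nothing against a route that proves `NP ⊄ P/poly`
first, and nothing against the DUALITY "`MCSP ∉ P/poly ↔ NP ⊄ P/poly`" by which route PneNP/Circuit2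
reads its crux #2 as an instance of its target: that duality HOLDS in `W` (both sides false;
`MCSPKarpHardness.duality_of_world`). The route file's inference "it is not implied by X either:
NP-hardness of MCSP under poly-time reductions already gives `EXP ≠ ZPP`"
(`Summits/PneNP/PneNP/Theses/Circuit2.lean`, crux #2) therefore draws no support from Thm. 1.6:
`X = NP ⊄ P/poly` itself gives `EXP ≠ ZPP`.

**2. What the printed arguments quantify over.** Every printed consequence concerns DETERMINISTIC,
UNIFORM reductions of BOUNDED ADAPTIVITY: many-one (Thm. 1.6), truth-table and polylog-round Turing
(Hitchcock–Pavan 2015, Cor. 4.4 / Thm. 4.5; Hirahara–Watanabe 2016, Thm. 1.3), parametric-honest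
or natural Turing (Saks–Santhanam 2020, Thms. 1–2; Kabanets–Cai), oracle-independent Turing
(Hirahara–Watanabe 2016, Thm. 1.1), and — unconditionally — sublinear-time local, logspace and
logtime-uniform `AC⁰` reductions (Thms. 1.3, 1.5, 1.7, 1.8). The mechanism (Thm. 4.1) bounds the
circuit complexity of the reduction's own output truth tables through `BITS_R ∈ EXP ⊆ P/poly`,
which needs `R` uniform and deterministic. Outside, with NO printed consequence: general adaptive
polynomial-time Turing reductions ("Nothing was known so far about consequences of NP-hardness of
MCSP under general Turing reductions"; "The main open problem is to derive circuit lower bounds from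
unrestricted Turing reductions from SAT to MCSP", Saks–Santhanam 2020, Abstract and §5); randomized
reductions of every kind (Murray–Williams §5: "we have none if it is hard under polynomial-time
randomized reductions"; indeed Impagliazzo–Kabanets–Volkovich 2018, Thm. 1 gives
`EXP ⊆ P/poly ⟹ EXP ⊆ ZPP^{MCSP}`, so IN `W` the problem `MCSP` IS `NP`-hard under ZPP-Turing
reductions and no ZPP-Turing analogue of Thm. 1.6 is provable short of proving `¬W`); non-uniform
reductions (in `W` — in any world with `NP ⊆ P/poly` — every `NP` language reduces to `MCSP` by a
polynomial-time map with polynomial advice, `advice_reducible_MCSP_of_NP_subset_PPoly` below, so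
uniformity of `R` is load-bearing; positively Allender–Hirahara 2017: `MKTP` is hard for `DET`
under non-uniform `NC⁰` reductions, Oliveira–Santhanam: `MCSP` is hard for `DET` under non-uniform
`TC⁰` truth-table reductions); non-black-box arguments (Kabanets–Cai: one-way functions give
`MCSP ∈ P ↔ P = NP`; Impagliazzo–Kabanets–Volkovich: under iO, `MCSP ∈ ZPP ↔ NP = ZPP`, "a
non-black box reduction from SAT to MCSP", Huang–Ilango–Ren 2023, §1.2); and conditional hardness
under hypotheses that already imply `¬W` (Huang–Ilango–Ren 2023, Cor. 2.5: subexponentially-secure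
SNARGs give NP-hardness of Gap-mvMCSP under DETERMINISTIC quasi-polynomial-time reductions;
Hirahara–Ilango, FOCS 2025, "NP-hardness of the Minimum Circuit Size Problem from Well-Studied
Assumptions"). The `K^t`-threshold crux of route PneNP/Ktlang (a randomized reduction to a
time-bounded-Kolmogorov language) lies outside on two counts.

**3. Formal content (all proved, axioms `propext`, `Classical.choice`, `Quot.sound`).**
`MCSPKarpHardness.world_iff`, `.world_consequences`, `.iff_not_isNPHard_of_world` (the fact IS
"in `W`, `MCSP` is not Karp-hard"), `.not_world_of_not_NP_subset_PPoly`, `.not_world_of_NP_ne_coNP`,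
`.not_world_of_P_eq_NP`, `.not_world_of_NP_ne_EXP`, `.not_world_of_not_EXP_subset_PPoly`,
`.duality_of_world`; the unconditional corollaries `exp_ne_np_inter_ppoly_of_not_NP_subset_PPoly`,
`exp_ne_np_inter_ppoly_of_NP_ne_coNP` (the breakthrough `EXP ≠ NP ∩ P/poly` from either hypothesis,
no `MCSP` involved); the narrowed barrier `MCSPKarpHardnessNarrow` with `MCSPKarpHardnessNarrow_holds`
and the converse `MCSPKarpHardnessNarrow.karpHardness`; and the advice-reduction triviality
`advice_reducible_MCSP_of_NP_subset_PPoly` / `advice_reducible_MCSP_of_world`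
(`exists_mem_MCSP`, `nil_not_mem_MCSP`).

## Sources

* [MurrayWilliams2017] Thms. 1.3, 1.5 (p. 3), Thm. 1.6, §4.1 (p. 14), Thms. 1.7, 1.8 (pp. 14–15),
  §5 Conclusion (PDF pp. 18–19: "we have none if it is hard under polynomial-time randomized
  reductions"; "can circuit lower bounds imply hardness results for circuit minimization?") — held
  (`paper:doi-10-4086-toc-2017-v013a004`).
* [HitchcockPavan2015] Abstract (p. 236), §1 (p. 238), Cor. 4.4 and Thm. 4.5 (p. 244) — read from
  the LIPIcs PDF (`paper:url-166be1a484f2`).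
* [SaksSanthanam2020] Abstract (p. 26:1), §1 (p. 26:2), §1.1 Thms. 1–2 (pp. 26:2–26:3), §5 (p. 26:11)
  — LIPIcs PDF (`paper:url-c0223ab099b3`).
* [HiraharaWatanabe2016] Abstract (p. 18:1), §1.1 (p. 18:2), Thm. 1.1 (p. 18:3), Thm. 1.2 (p. 18:4),
  Thms. 1.3–1.5 (p. 18:5) — LIPIcs PDF (`paper:url-0b354a07b3b0`).
* [AllenderHirahara2017] Abstract (p. 54:1), §1 (pp. 54:2–54:3, incl. fn. 2 on Oliveira–Santhanam)
  — LIPIcs PDF (`paper:url-973dbdd76210`); journal version [AllenderHirahara2019].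
* [ImpagliazzoKabanetsVolkovich2018] Abstract, §1, Thm. 1 (pp. 7:1–7:2) — CCC 2018 text
  (`galaxy-pdf-1109160800`).
* [HuangIlangoRen2023] §1.2 (p. 4), §2.2 (p. 8), Cor. 2.5 (p. 9), §3 (p. 11), §4 (p. 12) — held
  (`paper:doi-10-1145-3564246-3585154`).
* [MazorPass2024] Abstract (p. 1), §1 (p. 2), App. A — ECCC TR24-053 (`galaxy-pdf-5422092527603538200`).
* [HiraharaIlango2025] FOCS 2025 — title and venue only (text requested, acq-06189).
* [Ilango2023], [RenSanthanam2022], [OliveiraSanthanam2017], [AllenderDas2017], [KabanetsCai2000]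
  — through the quotations in the sources above, as marked.
-/

noncomputable section

namespace Literature.Barriers.PneNP

open _root_.Computability Literature.Computability.Complexity Literature.Computability.Complexity.Nondeterministic Literature.Computability.MetaComplexity
open scoped Literature.Computability.Complexity.Notation

/-! ### The excluded world `W : NP = EXP ⊆ P/poly` -/

/-- **The world excluded by Thm. 1.6.** Given `NP ⊆ EXP`: `EXP = NP ∩ P/poly` iff
`NP = EXP ∧ EXP ⊆ P/poly` (the printed proof uses exactly the two halves "`EXP ⊂ P/poly`" and
"`NEXP = EXP ⊆ NP`"). [cite: MurrayWilliams2015, proof of Thm. 1.3 (p. 375)] [cite: MurrayWilliams2017, Thm. 1.6 (p. 14)] -/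
theorem MCSPKarpHardness.world_iff (hNPEXP : NP_subset_EXP) :
    EXP = NP ∩ PPoly ↔ (NP = EXP ∧ EXP ⊆ PPoly) := by
  constructor
  · intro hE
    exact ⟨Set.Subset.antisymm hNPEXP fun L hL => (hE.subset hL).1, fun L hL => (hE.subset hL).2⟩
  · rintro ⟨hNE, hEP⟩
    rw [hNE]
    exact Set.Subset.antisymm (fun L hL => ⟨hL, hEP hL⟩) fun _ hL => hL.1

/-- `MCSPKarpHardness.world_iff` with `NP ⊆ EXP` discharged (`NP_subset_EXP_holds`).
[cite: MurrayWilliams2017, Thm. 1.6 (p. 14)] -/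
theorem MCSPKarpHardness.world_iff_holds : EXP = NP ∩ PPoly ↔ (NP = EXP ∧ EXP ⊆ PPoly) :=
  MCSPKarpHardness.world_iff NP_subset_EXP_holds

/-- **The whole content of the fact**: `MCSPKarpHardness` says exactly "in the world
`NP = EXP ⊆ P/poly`, `MCSP` is not NP-hard under Karp reductions".
[cite: MurrayWilliams2017, Thm. 1.6 (p. 14)] -/
theorem MCSPKarpHardness.iff_not_isNPHard_of_world (hNPEXP : NP_subset_EXP) :
    MCSPKarpHardness ↔ ((NP = EXP ∧ EXP ⊆ PPoly) → ¬ IsNPHard MCSP) :=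
  ⟨fun h hW hhard => h hhard ((MCSPKarpHardness.world_iff hNPEXP).2 hW),
    fun h hhard hE => h ((MCSPKarpHardness.world_iff hNPEXP).1 hE) hhard⟩

/-- **In the excluded world: `NP ⊆ P/poly`, `NP = coNP`, `NP = EXP`.** (So also `PH = MA = NP`
and, by the time hierarchy, `P ≠ NP`; not needed here.) [folklore] -/
theorem MCSPKarpHardness.world_consequences (hW : NP = EXP ∧ EXP ⊆ PPoly) :
    NP ⊆ PPoly ∧ NP = coNP ∧ NP = EXP := by
  refine ⟨fun _ hL => hW.2 (hW.1.subset hL), ?_, hW.1⟩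
  show NP = co NP
  rw [hW.1, co_EXP]

/-- **`NP ⊄ P/poly` already excludes the world** — the target of route PneNP/Circuit2 (and of
every circuit-lower-bound route to `P ≠ NP`) discharges the consequence of Thm. 1.6. [folklore] -/
theorem MCSPKarpHardness.not_world_of_not_NP_subset_PPoly (hX : ¬ NP ⊆ PPoly) :
    ¬ (NP = EXP ∧ EXP ⊆ PPoly) :=
  fun hW => hX fun _ hL => hW.2 (hW.1.subset hL)

/-- **`NP ≠ coNP` already excludes the world** (`EXP` is closed under complement, fed as the
hypothesis `co EXP = EXP`, the tree's `co_EXP` of `KannanLanguageAE.lean`). [folklore] -/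
theorem MCSPKarpHardness.not_world_of_NP_ne_coNP (hco : co EXP = EXP) (h : NP ≠ coNP) :
    ¬ (NP = EXP ∧ EXP ⊆ PPoly) := by
  rintro ⟨hNE, -⟩
  apply h
  show NP = co NP
  rw [hNE, hco]

/-- **`P = NP` already excludes the world** (given `P ≠ EXP`, the deterministic time hierarchy,
fed as a hypothesis): in `W`, `P = NP = EXP`. So `¬W` is implied both by `P = NP` and by the
circuit / proof-complexity strengthenings of `P ≠ NP`; only "`P ≠ NP` with `NP ⊆ P/poly` and
`NP = EXP`" is left for Thm. 1.6 to speak about. [folklore] -/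
theorem MCSPKarpHardness.not_world_of_P_eq_NP (hPEXP : Classes.P ≠ EXP) (h : Classes.P = NP) :
    ¬ (NP = EXP ∧ EXP ⊆ PPoly) :=
  fun hW => hPEXP (h.trans hW.1)

/-- `NP ≠ EXP` excludes the world (first conjunct). [folklore] -/
theorem MCSPKarpHardness.not_world_of_NP_ne_EXP (h : NP ≠ EXP) : ¬ (NP = EXP ∧ EXP ⊆ PPoly) :=
  fun hW => h hW.1

/-- `EXP ⊄ P/poly` excludes the world (second conjunct) — the Kabanets–Cai / natural-reduction
consequence is thus STRONGER than Thm. 1.6's, as Murray–Williams say ("We would like to strengthen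
Theorem 1.6 to ... `EXP ⊄ P/poly`"). [cite: MurrayWilliams2017, §4.1 (p. 14)] -/
theorem MCSPKarpHardness.not_world_of_not_EXP_subset_PPoly (h : ¬ EXP ⊆ PPoly) :
    ¬ (NP = EXP ∧ EXP ⊆ PPoly) :=
  fun hW => h hW.2

/-- **The Circuit2 duality holds in the excluded world.** Route PneNP/Circuit2 reads its crux #2
(`MCSP ∉ P/poly`) as "an instance of" its target `NP ⊄ P/poly` through the duality
`MCSP ∉ P/poly ↔ NP ⊄ P/poly`; in `W` both sides are false (`MCSP ∈ NP ⊆ P/poly`), so the duality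
is TRUE there and Thm. 1.6 — whose entire content is a statement about `W`
(`MCSPKarpHardness.iff_not_isNPHard_of_world`) — cannot obstruct it. (`MCSP ∈ NP` enters as the
tree fact `MCSP_mem_NP`, proved in `MCSPProofs.lean`.) [folklore] -/
theorem MCSPKarpHardness.duality_of_world (hM : MCSP_mem_NP) (hW : NP = EXP ∧ EXP ⊆ PPoly) :
    (MCSP ∉ PPoly ↔ ¬ NP ⊆ PPoly) := by
  have hNP : NP ⊆ PPoly := fun _ hL => hW.2 (hW.1.subset hL)
  exact ⟨fun h _ => h (hNP hM), fun h _ => h hNP⟩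

/-- **Murray–Williams' consequence without `MCSP`, I**: `NP ⊄ P/poly ⟹ EXP ≠ NP ∩ P/poly`
(unconditional; `NP ⊆ EXP` is `NP_subset_EXP_holds`). [folklore] -/
theorem exp_ne_np_inter_ppoly_of_not_NP_subset_PPoly (hX : ¬ NP ⊆ PPoly) : EXP ≠ NP ∩ PPoly :=
  fun hE => MCSPKarpHardness.not_world_of_not_NP_subset_PPoly hX
    (MCSPKarpHardness.world_iff_holds.1 hE)

/-- **Murray–Williams' consequence without `MCSP`, II**: `NP ≠ coNP ⟹ EXP ≠ NP ∩ P/poly`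
(unconditional). [folklore] -/
theorem exp_ne_np_inter_ppoly_of_NP_ne_coNP (h : NP ≠ coNP) : EXP ≠ NP ∩ PPoly :=
  fun hE => MCSPKarpHardness.not_world_of_NP_ne_coNP co_EXP h
    (MCSPKarpHardness.world_iff_holds.1 hE)

/-! ### The narrowed barrier -/

/-- **Narrowed barrier (D-0021 audit 2026-08-16) — the exact extent of the Murray–Williams
obstruction.** Formal content, four implications about the single world `W :≡ (NP = EXP ∧
EXP ⊆ P/poly)` that Thm. 1.6 excludes (`MCSPKarpHardness.world_iff`: given `NP ⊆ EXP`,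
`EXP = NP ∩ P/poly ↔ W`; in `W`: `NP ⊆ P/poly`, `NP = coNP = EXP`, hence `P ≠ NP`): (1) Thm. 1.6
itself — Karp (deterministic, uniform, many-one, polynomial-time) NP-hardness of `MCSP` refutes
`W`; (2) `NP ⊄ P/poly` refutes `W`; (3) `NP ≠ coNP` refutes `W`; (4) in `W` the duality
"`MCSP ∉ P/poly ↔ NP ⊄ P/poly`" of route PneNP/Circuit2 HOLDS. Proved: `MCSPKarpHardnessNarrow_holds`
((1) = `MCSPKarpHardness_holds`; (2)–(4) from `NP ⊆ EXP`, `co·EXP = EXP`, `MCSP ∈ NP`). So the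
consequence that makes Thm. 1.6 an obstruction is discharged by the target of every
circuit-lower-bound route, by `NP ≠ coNP`, by `P = NP`, by `NP ≠ EXP`, by `EXP ⊄ P/poly`: the
theorem prices the ORDER of steps — Karp-hardness of `MCSP` cannot be had before (or without) a
statement of strength `¬W` — and is silent on `X → IsNPHard MCSP`, on the duality (4), and on every
reduction outside its class (E1)–(E6).

BARRIER (narrowed replacement of the block of `MCSPKarpHardness`; every clause quotes or closely paraphrases the cited locus)
technique_class: deterministic-uniform-many-one-reductions-to-mcsp, truth-table-reductions-to-mcsp, polylog-adaptive-turing-reductions-to-mcsp, natural-reductions-to-mcsp, parametric-honest-reductions-to-mcsp, oracle-independent-reductions-to-mcsp, sublinear-time-local-reductions, logspace-reductions-to-mcsp, uniform-ac0-reductions-to-mcsp — and NOT the broad tags `np-hardness-reductions`, `gadget-reductions`, `mcsp`, `meta-complexity` of the original block: general adaptive polynomial-time Turing reductions, randomized reductions of every kind, non-uniform reductions, non-black-box arguments and hypothesis-discharging (conditional) hardness proofs are outside every printed consequence (evasions (E1)–(E6)).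
blocks: (B1) a proof that `MCSP` (general circuits, explicit truth table; by the same proofs `MKTP` [cite: AllenderHirahara2017, §1 (p. 54:2)]) is NP-hard under a DETERMINISTIC, UNIFORM polynomial-time reduction of BOUNDED ADAPTIVITY, offered as a step that does not also prove a separation at least as strong as `¬W` — many-one: `EXP ≠ NP ∩ P/poly`, hence `EXP ≠ ZPP` (conjunct (1); `MCSPKarpHardness_holds`, `exp_ne_zpp_of_isNPHard_MCSP`) [cite: MurrayWilliams2017, Thm. 1.6 (p. 14)]; truth-table (nonadaptive): `EXP ≠ ZPP` and `EXP ≠ NP ∩ SIZE(2^{n^ε})` [cite: HitchcockPavan2015, Cor. 4.4 (p. 244)], indeed `P_{||}^{MCSP} ∩ P/poly ≠ EXP` unconditionally [cite: HiraharaWatanabe2016, Thm. 1.3 (p. 18:5)]; polylog-round Turing: the same [cite: HitchcockPavan2015, Thm. 4.5 (p. 244)]; parametric-honest or natural Turing: `E ⊄ SIZE(poly)` [cite: SaksSanthanam2020, Thms. 1–2 (pp. 26:2–26:3)]; natural many-one: `E ⊄ P/poly` (Kabanets–Cai) [cite: SaksSanthanam2020, §1 (p. 26:2)] [cite: KabanetsCai2000];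 oracle-independent deterministic Turing reductions decide only `P` (`⋂_A P^{MCSP^A} = P`), one-query randomized oracle-independent ones only `AM ∩ coAM` [cite: HiraharaWatanabe2016, Thms. 1.1–1.2 (pp. 18:3–18:4)]; Turing reductions to the approximation problems `GapₖMCSP` for all `k`: `P^L ∩ P/poly ≠ EXP` [cite: HiraharaWatanabe2016, Thm. 1.5 (p. 18:5)]; (B2) unconditionally impossible: `TIME(n^δ)` local reductions, `δ < 1/2` (randomized: `δ < 1/5`), even from PARITY [cite: MurrayWilliams2017, Thms. 1.3, 1.5 (p. 3)]; and logspace resp. logtime-uniform `AC⁰` reductions give `PSPACE ≠ ZPP` resp. `NP ⊄ P/poly ∧ P = BPP` [cite: MurrayWilliams2017, Thms. 1.7, 1.8 (pp. 14–15)]. NOT blocked, against the original block's list of routes: route PneNP/Circuit2's duality `MCSP ∉ P/poly ↔ NP ⊄ P/poly` (conjunct (4): true in `W`; its non-trivial direction wants NON-UNIFORM hardness, (E3)); any conditional `NP ⊄ P/poly → IsNPHard MCSP`, `NP ≠ coNP → …` (conjuncts (2)–(3)); route PneNP/Ktlang's crux (a RANDOMIZED reduction to a `K^t`-threshold language: another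 measure and another reduction type, (E2) — the pertinent limits there are Ko's relativization, oracle independence and the `t`-growth of randomized non-adaptive reductions to `K^t` [cite: MazorPass2024, §1 (p. 2)] [cite: HuangIlangoRen2023, §4 (p. 12)]).
because: the mechanism bounds the witness complexity of the reduction's OWN outputs — "instances of MCSP are written in a rather non-succinct way: the entire truth table of the function is provided", so for padded sparse `NTIME(2^{n^c})` languages `BITS_R ∈ EXP` and, under `EXP ⊆ P/poly`, the output truth tables have polynomial-size circuits and `NEXP = EXP` (Thm. 4.1, `MurrayWilliams2017_thm_4_1_holds`) [cite: MurrayWilliams2017, §1.1 (p. 4) and §4.1 (p. 14)]; this needs `R` uniform (`BITS_R ∈ EXP`; cf. (E3) and `advice_reducible_MCSP_of_NP_subset_PPoly`), deterministic (a random string is itself a hard truth table: reductions "rely on the fact that a randomly chosen truth-table requires high circuit complexity" [cite: HiraharaWatanabe2016, §1.2 (p. 18:3)]) and of bounded adaptivity ("Unfortunately, we could not prove `EXP ≠ P^{Kt}`", unsettled since Allender–Buhrman–Koucký–van Melkebeek–Ronneburger 2006 [cite: HiraharaWatanabe2016, §1.3 (p. 18:5)]); and its conclusion is weak: `W → NP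 ⊆ P/poly ∧ NP = coNP ∧ NP = EXP` (`MCSPKarpHardness.world_consequences`).
evasions_known: (E1) ADAPTIVE polynomial-time Turing reductions: "Nothing was known so far about consequences of NP-hardness of MCSP under general Turing reductions"; their §5 names as the principal question left unsettled "to derive circuit lower bounds from unrestricted Turing reductions from SAT to MCSP", next to "An easier problem ... to derive circuit lower bounds from unrestricted many-one reductions from SAT to MCSP. Even this is unknown, though we do know that such reductions imply EXP ≠ ZPP" [cite: SaksSanthanam2020, Abstract (p. 26:1) and §5 (p. 26:11)]; "every language in P reduces to MCSP under parametric honest Turing reductions" [cite: SaksSanthanam2020, §1.1 (p. 26:3)]. (E2) RANDOMIZED reductions (BPP / ZPP / one-sided; many-one or Turing): "While we have proven consequences if MCSP is NP-hard under general polynomial-time reductions, we have none if it is hard under polynomial-time randomized reductions" [cite: MurrayWilliams2017, §5 (p. 19)]; `MCSP` is SZK-hard under BPP-Turing reductions (Allender–Das) [cite: HiraharaWatanabe2016, §1.1 (p. 18:2)] [cite: AllenderDas2017]; for `Γ ∈ {⊕P, P^{#P}, PSPACE, EXP, NEXP, EXP^{NP}}`, "If `Γ ⊆ P/poly`, then `Γ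 ⊆ ZPP^{MCSP}`" [cite: ImpagliazzoKabanetsVolkovich2018, Thm. 1 (p. 7:2)] — hence IN `W` one has `NP = EXP ⊆ ZPP^{MCSP}`: `MCSP` IS NP-hard under ZPP-Turing reductions in the very world Thm. 1.6 excludes, and no ZPP-Turing analogue of Thm. 1.6 can be proved short of proving `¬W` outright; "it seems more likely that the aforementioned negative hardness results are in fact about the weakness of certain reductions, and that it may be the case that MCSP is NP-hard under, say, general randomized polynomial-time reductions" [cite: ImpagliazzoKabanetsVolkovich2018, §1 (p. 7:2)]; `MCSP*` IS NP-hard under randomized many-one reductions (tree theorem `isRandNPHard_MCSPStar`) [cite: Hirahara2022, Thm. 1.2], Multi-MCSP likewise [cite: HuangIlangoRen2023, §3 (p. 11)]; the printed limits on randomized reductions concern restricted forms only — one-query oracle-independent [cite: HiraharaWatanabe2016, Thm. 1.2 (p. 18:4)], Levin (witness-preserving) reductions to GapMCSP assuming iO and subexponentially-secure one-way functions [cite: MazorPass2024, Abstract (p. 1)], and the `t`-growth of non-adaptive randomized reductions to `K^t` [cite: MazorPass2024, §1 (p. 2)]. (E3) NON-UNIFORM reductions: in `W` — in any world with `NP ⊆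 P/poly` — every `NP` language reduces to `MCSP` by a polynomial-time map with polynomial advice (`advice_reducible_MCSP_of_NP_subset_PPoly`, `advice_reducible_MCSP_of_world`), so Thm. 1.6 has no non-uniform analogue; positively, "MKTP is hard for the complexity class DET under non-uniform NC⁰ reductions", "Contrary to these expectations" raised by the local no-go (B2) [cite: AllenderHirahara2017, Abstract (p. 54:1) and §1 (p. 54:3)], and "MCSP and MKTP are hard for DET under non-uniform ≤^{TC⁰}_{tt} reductions" (Oliveira–Santhanam) [cite: AllenderHirahara2017, §1 fn. 2 (p. 54:3)] [cite: OliveiraSanthanam2017]; non-uniform (`P/poly`-Turing) NP-hardness is exactly what the Circuit2 duality (4) needs. (E4) NON-BLACK-BOX arguments: "a trivial corollary of Kabanets and Cai is that if one-way functions exist, then MCSP ∈ P if and only if P = NP", and under iO "MCSP ∈ ZPP if and only if NP = ZPP. Their proof can be viewed as a non-black box reduction from SAT to MCSP" [cite: HuangIlangoRen2023, §1.2 (p. 4)] [cite: ImpagliazzoKabanetsVolkovich2018, Abstract (p. 7:1)] — there is no reduction `R` for Thm. 4.1 to bound. (E5) CONDITIONAL or ORACLE hardness under hypotheses that already imply `¬W`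 (conjuncts (2)–(3)): "Suppose that subexponentially-secure SNARGs exist. Then for every `λ`, Gap_λ-mvMCSP is NP-hard under deterministic quasi-polynomial time reductions" [cite: HuangIlangoRen2023, Cor. 2.5 (p. 9)]; approximating MOCSP is NP-hard (oracle witness encryption), where "essentially the same proof as in [MW] shows that if MOCSP is NP-hard under deterministic polynomial-time reductions, then EXP ≠ ZPP" [cite: HuangIlangoRen2023, Thm. 2.3 and §2.2 (p. 8)]; GapMCSP and Gap-MK^tP are NP-hard relative to a random oracle by a many-one (indeed Levin) reduction [cite: Ilango2023] [cite: MazorPass2024, §1 (p. 2) and App. A]; "NP-hardness of the Minimum Circuit Size Problem from Well-Studied Assumptions" [cite: HiraharaIlango2025]; and Murray–Williams' own question "can circuit lower bounds imply hardness results for circuit minimization?" [cite: MurrayWilliams2017, §5 (p. 19)] is answered affirmatively in settings: "Circuit size lower bounds are equivalent to hardness of a relativized version MKTP^A of MKTP under a class of uniform AC⁰ reductions, for a large class of sets A" [cite: AllenderHirahara2017, Abstract (p. 54:1) and §1 (p. 54:2)]. (E6) NON-RELATIVIZING, not oracle-independent reductions: Ko's relativization barrier (MINLT) "was overcome by [Hirahara]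 using non-relativising techniques such as the PCP theorem" [cite: HuangIlangoRen2023, §4 (p. 12)]; "We give a concrete example of a ... reduction that (under a plausible complexity assumption) reduces DET to MKTP. This is not an oracle independent reduction" [cite: AllenderHirahara2017, §1 (p. 54:3)]; there are oracles relative to which `MCSP` is not NP-complete [cite: RenSanthanam2022] [cite: MazorPass2024, §1 (p. 2)], so an unconditional hardness proof is non-relativizing — which every proof of the summit is anyway (`Literature.Barriers.PneNP.Relativization`).
scope_caveats: (a) formal content = conjuncts (1)–(4) over the tree's `MCSP` (truth table `boolPair`ed with the size bound in binary), `IsNPHard` (Karp), `NP`, `coNP`, `EXP`, `PPoly`; (1) is Thm. 1.6 (`MCSPKarpHardness_holds`), (2)–(4) are three-line class manipulations — the narrowing is a reading of WHAT (1) obstructs, not new mathematics; the truth-table / Turing / local / logspace / `AC⁰` / oracle-independent statements of (B1)–(B2) and all of (E1)–(E6) except the advice triviality are quoted, not formalised (the tree has no Turing-, tt-, randomized-Turing- or advice-reducibility API for `MCSP` beyond `≤ₚ`, `≤ᵣₚ`); (b) outside (B2) this is an "implies a breakthrough" obstruction, never an impossibility: `¬W` is believed TRUE, so (B1) prices a step,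 it does not forbid it — "Note that this does not give evidence against NP-hardness" [cite: SaksSanthanam2020, §1 (p. 26:2)]; "These results, however, only rule out quite limited types of reductions. Despite this progress, the original question, however, remains wide open" [cite: MazorPass2024, §1 (p. 2)]; (c) the original block's locus "§6 (p. 19)" in [MurrayWilliams2017] is §5 (Conclusion), PDF pp. 18–19 of the ToC version; (d) [HiraharaIlango2025] is cited by title and venue only (text requested, acq-06189): its reduction type and assumptions are not verified here; (e) the advice reduction of (E3) is the `≤^{P/poly}_m` triviality of ANY world with `NP ⊆ P/poly`, recorded only to exhibit that uniformity of `R` is load-bearing in Thm. 4.1 (`BITS_R ∈ EXP`); (f) `P ≠ EXP` (for `…not_world_of_P_eq_NP`) enters as a hypothesis — the deterministic time hierarchy is not restated here.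
status: established — (1) is Murray–Williams Thm. 1.6, a theorem of the tree; (2)–(4) proved here; narrowed from `MCSPKarpHardness` by the barrier audit of 2026-08-16 [cite: MurrayWilliams2017, Thm. 1.6 (p. 14)] [cite: SaksSanthanam2020, §5 (p. 26:11)] [cite: ImpagliazzoKabanetsVolkovich2018, Thm. 1 (p. 7:2)] -/
def MCSPKarpHardnessNarrow : Prop :=
  (IsNPHard MCSP → ¬ (NP = EXP ∧ EXP ⊆ PPoly)) ∧
  (¬ (NP ⊆ PPoly) → ¬ (NP = EXP ∧ EXP ⊆ PPoly)) ∧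
  (NP ≠ coNP → ¬ (NP = EXP ∧ EXP ⊆ PPoly)) ∧
  ((NP = EXP ∧ EXP ⊆ PPoly) → (MCSP ∉ PPoly ↔ ¬ NP ⊆ PPoly))

/-- The narrowed barrier from the fact and three class facts (`NP ⊆ EXP`, `co·EXP = EXP`,
`MCSP ∈ NP`), as hypotheses. [cite: MurrayWilliams2017, Thm. 1.6 (p. 14)] -/
theorem MCSPKarpHardnessNarrow.of_fact (h : MCSPKarpHardness) (hNPEXP : NP_subset_EXP)
    (hco : co EXP = EXP) (hM : MCSP_mem_NP) : MCSPKarpHardnessNarrow :=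
  ⟨fun hhard hW => (MCSPKarpHardness.iff_not_isNPHard_of_world hNPEXP).1 h hW hhard,
    MCSPKarpHardness.not_world_of_not_NP_subset_PPoly, MCSPKarpHardness.not_world_of_NP_ne_coNP hco,
    MCSPKarpHardness.duality_of_world hM⟩

/-- **The narrowed barrier holds** (D-0014 discharge): Thm. 1.6 is `MCSPKarpHardness_holds`
(`MCSPHardnessObstructionsProofs.lean`), the class facts are `NP_subset_EXP_holds`, `co_EXP` (`KannanLanguageAE.lean`),
`MCSP_mem_NP_holds`. [cite: MurrayWilliams2017, Thm. 1.6 (p. 14)] -/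
theorem MCSPKarpHardnessNarrow_holds : MCSPKarpHardnessNarrow :=
  MCSPKarpHardnessNarrow.of_fact MCSPKarpHardness_holds NP_subset_EXP_holds co_EXP MCSP_mem_NP_holds

/-- Conversely the narrowed statement gives back the catalogued fact (given `NP ⊆ EXP`): nothing
of Thm. 1.6 is lost. [cite: MurrayWilliams2017, Thm. 1.6 (p. 14)] -/
theorem MCSPKarpHardnessNarrow.karpHardness (h : MCSPKarpHardnessNarrow) (hNPEXP : NP_subset_EXP) :
    MCSPKarpHardness :=
  (MCSPKarpHardness.iff_not_isNPHard_of_world hNPEXP).2 fun hW hhard => h.1 hhard hW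

/-! ### Uniformity is load-bearing: advice reductions in any world with `NP ⊆ P/poly` -/

/-- A yes-instance of `MCSP`: the `0`-ary constant function with its own circuit complexity as
the bound. [folklore] -/
theorem exists_mem_MCSP : ∃ y : List Bool, y ∈ MCSP :=
  ⟨_, 0, fun _ => false, _, rfl, le_rfl⟩

/-- A no-instance of `MCSP`: the empty string is not a `boolPair` code. [folklore] -/
theorem nil_not_mem_MCSP : ([] : List Bool) ∉ MCSP := by
  rintro ⟨n, F, s, h, -⟩
  have := congrArg List.length h
  simp only [List.length_nil, length_boolPair] at this
  omega

/-- **`NP ⊆ P/poly` makes `MCSP` NP-hard under polynomial-time reductions with polynomial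
advice (`≤^{P/poly}_m`).** For `L ∈ NP ⊆ P/poly = P/poly-advice` (`PPoly_subset_polyAdvice_P`)
take the `P`-language `L'` and advice `a` with `x ∈ L ↔ ⟨x, a_{|x|}⟩ ∈ L'`, and map a pair to a
fixed yes- resp. no-instance according to membership in `L'` (`iteFn`, `indicatorFn_mem_FP`). In
particular this holds in the world `W` excluded by Thm. 1.6 (`advice_reducible_MCSP_of_world`):
Murray–Williams' proof (Thm. 4.1: `BITS_R ∈ EXP`) uses the UNIFORMITY of the reduction, and no
analogue of Thm. 1.6 for non-uniform many-one reductions can hold short of `¬W` itself — whereas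
non-uniform hardness results for `MCSP`/`MKTP` exist unconditionally ("MKTP is hard for DET under
non-uniform NC⁰ reductions"). [cite: AllenderHirahara2017, Abstract (p. 54:1) and §1 (p. 54:3)] [cite: MurrayWilliams2017, Thm. 4.1 (p. 14)] -/
theorem advice_reducible_MCSP_of_NP_subset_PPoly (hNP : NP ⊆ PPoly) :
    ∀ L ∈ NP, ∃ f ∈ FP, ∃ a : ℕ → List Bool, ∃ p : Polynomial ℕ,
      (∀ n, (a n).length ≤ p.eval n) ∧ ∀ x, x ∈ L ↔ f (boolPair x (a x.length)) ∈ MCSP := by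
  intro L hL
  obtain ⟨L', hL'P, a, p, ha, hx⟩ := PPoly_subset_polyAdvice_P (hNP hL)
  obtain ⟨y, hy⟩ := exists_mem_MCSP
  set c : List Bool → List Bool := fun w => encodeBool (L'.boolIndicator w) with hcdef
  have hcFP : c ∈ FP := indicatorFn_mem_FP hL'P
  refine ⟨iteFn c (fun _ => y) (fun _ => []), iteFn_mem_FP hcFP (const_mem_FP _) (const_mem_FP _),
    a, p, ha, fun x => ?_⟩
  rw [hx]
  set z := boolPair x (a x.length)
  by_cases h : z ∈ L'
  · have hc : c z = [true] := by
      rw [hcdef]; simp only [(Set.mem_iff_boolIndicator _ _).1 h]; rfl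
    rw [iteFn_apply_true (c := c) (z := z) (f := fun _ => y) (g := fun _ => []) hc]
    exact ⟨fun _ => hy, fun _ => h⟩
  · have hc : c z = [false] := by
      rw [hcdef]; simp only [(Set.notMem_iff_boolIndicator _ _).1 h]; rfl
    rw [iteFn_apply_false (c := c) (z := z) (f := fun _ => y) (g := fun _ => []) hc]
    exact ⟨fun h' => absurd h' h, fun h' => absurd h' nil_not_mem_MCSP⟩

/-- **In the world excluded by Thm. 1.6, `MCSP` is NP-hard under advice reductions** — the
non-uniform analogue of the hypothesis of Thm. 1.6 holds exactly where its conclusion fails.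
[cite: MurrayWilliams2017, Thm. 1.6 and Thm. 4.1 (p. 14)] -/
theorem advice_reducible_MCSP_of_world (hW : NP = EXP ∧ EXP ⊆ PPoly) :
    ∀ L ∈ NP, ∃ f ∈ FP, ∃ a : ℕ → List Bool, ∃ p : Polynomial ℕ,
      (∀ n, (a n).length ≤ p.eval n) ∧ ∀ x, x ∈ L ↔ f (boolPair x (a x.length)) ∈ MCSP :=
  advice_reducible_MCSP_of_NP_subset_PPoly (MCSPKarpHardness.world_consequences hW).1

end Literature.Barriers.PneNP

end
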